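import Summits.AtomisticToContinuum.Crystallization.Theses.PhononSlackCertificates

/-!
# `HullBridge` (route `PhononSlackCertificates`), part 1: layered windows — rescaling, one
# spacing for all scales, packing counts

Support file for item stmt-AtomisticToContinuum-13961 (`HullBridge : CoerciveTwoShellGap →
NearFieldConvexity → CrysEnergyLimit → LayeredWindows`). This part is pure geometry /
bookkeeping about the WINDOW predicate of `LayeredWindows` (a two-way `ε`-match on `B(0, R)` of
the translated configuration with a layered set `{A (i u(a) + j v(a) + L_s(m) w(a) + z(m) e₃)}`):

* `hb_window_rescale` — a `(2R+1, ε/2)`-window with in-layer spacing `a'` gives an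
  `(R, ε)`-window with any spacing `a`, `|a - a'| ≤ ε/(8(R+1))` (homothety of ratio `a/a'`, heights
  rescaled with it so the interlayer box `[39a/50, 17a/20]` is kept);
* `hb_exists_global_spacing` — abstract accumulation-point argument turning "windows eventually
  in `N` for every `(R, ε)` with SOME spacing in `[47/50, 1]`" into "ONE spacing for all `(R, ε)`,
  frequently in `N`" (`Filter.extraction_forall_of_eventually` + `IsCompact.tendsto_subseq`);
* `hb_window_mono`, `hb_window_neg` — monotonicity and the vacuous negative-radius case;
* `hb_card_near_le`, `hb_exists_far_from` — packing count of the particles within `R'` of a set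
  `D` in a `δ`-separated configuration (`card_le_of_separated_of_dist_le`), and a particle with no
  member of `D` within `R'` when `#D (2R'/δ+1)³ < N`.

Part 2 (`PhononSlackCertificatesHullBridge.lean`) does the energy bookkeeping and assembles the
bridge modulo the layered-integration lemma. No new definitions; nothing here is specific to
Lennard-Jones except the packing lemma's ambient `ℝ³`.
-/

namespace Summit.AtomisticToContinuum.Crystallization.Theorems

open scoped BigOperators
open Filter Topology
open Literature.MathematicalPhysics.StatisticalMechanics Literature.Geometry.DiscreteGeometry

local notation "E3" => EuclideanSpace ℝ (Fin 3)

/-! ## Scaling of the layered sets -/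

/-- `u(c a) = c • u(a)`. [folklore] -/
theorem hb_triangularVec₁_mul (c a : ℝ) : triangularVec₁ (c * a) = c • triangularVec₁ a := by
  ext i
  fin_cases i <;> simp [triangularVec₁]

/-- `v(c a) = c • v(a)`. [folklore] -/
theorem hb_triangularVec₂_mul (c a : ℝ) : triangularVec₂ (c * a) = c • triangularVec₂ a := by
  ext i
  fin_cases i <;> simp [triangularVec₂] <;> ring

/-- `w(c a) = c • w(a)`. [folklore] -/
theorem hb_barlowOffset_mul (c a : ℝ) : barlowOffset (c * a) = c • barlowOffset a := by
  ext i
  fin_cases i <;> simp [barlowOffset] <;> ring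

/-- Scaling a layered point: in-layer spacing `c a`, heights `c z` is `c •` the point with
spacing `a`, heights `z`. [folklore] -/
theorem hb_layeredPoint_mul (A : E3 →ₗᵢ[ℝ] E3) (c a : ℝ) (s : ℤ → ℤ) (z : ℤ → ℝ) (m i j : ℤ) :
    A (((i : ℝ) • triangularVec₁ (c * a)) + ((j : ℝ) • triangularVec₂ (c * a)) +
        ((haggLabel s m : ℝ) • barlowOffset (c * a)) + ((c * z m) • layerNormal 1)) =
      c • A (((i : ℝ) • triangularVec₁ a) + ((j : ℝ) • triangularVec₂ a) +
        ((haggLabel s m : ℝ) • barlowOffset a) + (z m • layerNormal 1)) := by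
  rw [← A.map_smul, hb_triangularVec₁_mul, hb_triangularVec₂_mul, hb_barlowOffset_mul]
  congr 1
  simp only [smul_add, smul_smul, mul_comm c]

/-! ## Rescaling a layered window to a prescribed in-layer spacing -/

/-- Elementary bound used twice in the rescaling lemma. [folklore] -/
theorem hb_rescale_aux {R ε a a' X Q : ℝ} (hR : 0 ≤ R) (hε : 0 < ε) (ha : 47 / 50 ≤ a)
    (ha' : 47 / 50 ≤ a') (ha'1 : a' ≤ 1) (ha1 : a ≤ 1)
    (hXa : X * a' = |a - a'|) (haa : |a - a'| ≤ ε / (8 * (R + 1))) (hX : 0 ≤ X)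
    (hQR : Q ≤ 2 * R + ε / 2) : X * Q ≤ ε / 2 := by
  have hR1 : 0 < 8 * (R + 1) := by positivity
  have hκ : |a - a'| * (8 * (R + 1)) ≤ ε := by
    have := (le_div_iff₀ hR1).1 haa
    linarith
  have h3 : |a - a'| ≤ 3 / 50 := by
    rw [abs_le]; constructor <;> linarith
  -- `X ≤ |a - a'| / a' ≤ (50/47) |a - a'|`
  have hX1 : X * (47 / 50) ≤ |a - a'| := by
    calc X * (47 / 50) ≤ X * a' := mul_le_mul_of_nonneg_left ha' hX
      _ = |a - a'| := hXa
  -- `X * R * 8 (R+1) * (47/50) ≤ ε R`, `X ≤ 3/47`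
  have hXR : X * (2 * R) * (47 / 50) * (8 * (R + 1)) ≤ ε * (2 * R) := by
    have := mul_le_mul_of_nonneg_right hX1 (by positivity : (0 : ℝ) ≤ 2 * R * (8 * (R + 1)))
    nlinarith [mul_le_mul_of_nonneg_right hκ (by positivity : (0 : ℝ) ≤ 2 * R)]
  have hX3 : X * (47 / 50) ≤ 3 / 50 := hX1.trans h3
  -- now conclude
  have hXQ' : X * Q ≤ X * (2 * R) + X * (ε / 2) := by nlinarith
  have hA : X * (2 * R) ≤ ε * (2 * R) / ((47 / 50) * (8 * (R + 1))) := by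
    rw [le_div_iff₀ (by positivity)]
    nlinarith
  have hA' : ε * (2 * R) / ((47 / 50) * (8 * (R + 1))) ≤ ε * (50 / 188) := by
    rw [div_le_iff₀ (by positivity)]
    nlinarith
  have hB : X * (ε / 2) ≤ 3 / 47 * (ε / 2) := by
    have : X ≤ 3 / 47 := by linarith
    exact mul_le_mul_of_nonneg_right this (by positivity)
  nlinarith

/-- **Rescaling a layered window.** A window of radius `2R + 1` and tolerance `ε/2` whose layered
set has in-layer spacing `a'` yields, after the homothety of ratio `a/a'` (heights rescaled with
it, so the interlayer constraints are kept), a window of radius `R` and tolerance `ε` with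
in-layer spacing `a`, as soon as `|a - a'| ≤ ε / (8 (R + 1))` (both spacings in `[47/50, 1]`).
[folklore] -/
theorem hb_window_rescale {N : ℕ} (y : Fin N → E3) {R ε a a' : ℝ}
    (hR : 0 ≤ R) (hε : 0 < ε) (ha : 47 / 50 ≤ a) (ha1 : a ≤ 1) (ha' : 47 / 50 ≤ a')
    (ha'1 : a' ≤ 1) (haa : |a - a'| ≤ ε / (8 * (R + 1)))
    (hW : ∃ (A : E3 →ₗᵢ[ℝ] E3) (t : E3) (s : ℤ → ℤ) (z : ℤ → ℝ), IsHaggSeq s ∧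
      (∀ m : ℤ, 39 / 50 * a' ≤ z (m + 1) - z m ∧ z (m + 1) - z m ≤ 17 / 20 * a') ∧
      let S : Set E3 := {p | ∃ m i j : ℤ, p = A (((i : ℝ) • triangularVec₁ a') +
        ((j : ℝ) • triangularVec₂ a') + ((haggLabel s m : ℝ) • barlowOffset a') +
        (z m • layerNormal 1))}
      (∀ p ∈ S, ‖p‖ ≤ 2 * R + 1 → ∃ i : Fin N, dist (y i + t) p ≤ ε / 2) ∧
      (∀ i : Fin N, ‖y i + t‖ ≤ 2 * R + 1 → ∃ p ∈ S, dist (y i + t) p ≤ ε / 2)) :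
    ∃ (A : E3 →ₗᵢ[ℝ] E3) (t : E3) (s : ℤ → ℤ) (z : ℤ → ℝ), IsHaggSeq s ∧
      (∀ m : ℤ, 39 / 50 * a ≤ z (m + 1) - z m ∧ z (m + 1) - z m ≤ 17 / 20 * a) ∧
      let S : Set E3 := {p | ∃ m i j : ℤ, p = A (((i : ℝ) • triangularVec₁ a) +
        ((j : ℝ) • triangularVec₂ a) + ((haggLabel s m : ℝ) • barlowOffset a) +
        (z m • layerNormal 1))}
      (∀ p ∈ S, ‖p‖ ≤ R → ∃ i : Fin N, dist (y i + t) p ≤ ε) ∧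
      (∀ i : Fin N, ‖y i + t‖ ≤ R → ∃ p ∈ S, dist (y i + t) p ≤ ε) := by
  obtain ⟨A, t, s, z, hs, hz, h12⟩ := hW
  dsimp only at h12
  obtain ⟨h1, h2⟩ := h12
  have ha'0 : 0 < a' := by linarith
  have ha0 : 0 < a := by linarith
  set c : ℝ := a / a' with hc
  have hc0 : 0 < c := div_pos ha0 ha'0
  have hca : c * a' = a := div_mul_cancel₀ a ha'0.ne'
  have hXa : |c - 1| * a' = |a - a'| := by
    rw [← abs_of_pos ha'0, ← abs_mul, abs_of_pos ha'0, sub_mul, hca, one_mul]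
  -- the rescaled point is `c •` the old one
  have key : ∀ m i j : ℤ, A (((i : ℝ) • triangularVec₁ a) + ((j : ℝ) • triangularVec₂ a) +
      ((haggLabel s m : ℝ) • barlowOffset a) + ((c * z m) • layerNormal 1)) =
      c • A (((i : ℝ) • triangularVec₁ a') + ((j : ℝ) • triangularVec₂ a') +
      ((haggLabel s m : ℝ) • barlowOffset a') + (z m • layerNormal 1)) := by
    intro m i j
    have := hb_layeredPoint_mul A c a' s z m i j
    rwa [hca] at this
  have hdist : ∀ q : E3, dist q (c • q) = |c - 1| * ‖q‖ := by
    intro q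
    rw [dist_eq_norm, show q - c • q = (1 - c) • q by rw [sub_smul, one_smul], norm_smul,
      Real.norm_eq_abs, abs_sub_comm]
  refine ⟨A, t, s, fun m => c * z m, hs, fun m => ?_, ?_⟩
  · obtain ⟨hl, hu⟩ := hz m
    have e1 : c * z (m + 1) - c * z m = c * (z (m + 1) - z m) := by ring
    rw [e1]
    constructor
    · calc 39 / 50 * a = c * (39 / 50 * a') := by rw [← hca]; ring
        _ ≤ c * (z (m + 1) - z m) := mul_le_mul_of_nonneg_left hl hc0.le
    · calc c * (z (m + 1) - z m) ≤ c * (17 / 20 * a') := mul_le_mul_of_nonneg_left hu hc0.le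
        _ = 17 / 20 * a := by rw [← hca]; ring
  dsimp only
  constructor
  · rintro p ⟨m, i, j, rfl⟩ hpR
    set q : E3 := A (((i : ℝ) • triangularVec₁ a') + ((j : ℝ) • triangularVec₂ a') +
      ((haggLabel s m : ℝ) • barlowOffset a') + (z m • layerNormal 1)) with hq
    rw [key] at hpR ⊢
    have hqS : q ∈ {p : E3 | ∃ m i j : ℤ, p = A (((i : ℝ) • triangularVec₁ a') +
        ((j : ℝ) • triangularVec₂ a') + ((haggLabel s m : ℝ) • barlowOffset a') +
        (z m • layerNormal 1))} := ⟨m, i, j, rfl⟩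
    have hcq : c * ‖q‖ ≤ R := by rwa [norm_smul, Real.norm_eq_abs, abs_of_pos hc0] at hpR
    have hc1 : 47 / 50 ≤ c := by
      rw [hc, le_div_iff₀ ha'0]; nlinarith
    have hqn : ‖q‖ ≤ 2 * R + 1 := by nlinarith [norm_nonneg q]
    obtain ⟨i₀, hi₀⟩ := h1 q hqS hqn
    refine ⟨i₀, ?_⟩
    have hqR' : ‖q‖ ≤ 2 * R + ε / 2 := by nlinarith [norm_nonneg q]
    calc dist (y i₀ + t) (c • q) ≤ dist (y i₀ + t) q + dist q (c • q) := dist_triangle _ _ _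
      _ ≤ ε / 2 + |c - 1| * ‖q‖ := by rw [hdist]; linarith
      _ ≤ ε / 2 + ε / 2 := by
          linarith [hb_rescale_aux hR hε ha ha' ha'1 ha1 hXa haa (abs_nonneg _) hqR']
      _ = ε := by ring
  · intro i hi
    have hi' : ‖y i + t‖ ≤ 2 * R + 1 := by linarith
    obtain ⟨q, ⟨m, i', j', rfl⟩, hq⟩ := h2 i hi'
    refine ⟨_, ⟨m, i', j', rfl⟩, ?_⟩
    rw [key]
    set q : E3 := A (((i' : ℝ) • triangularVec₁ a') + ((j' : ℝ) • triangularVec₂ a') +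
      ((haggLabel s m : ℝ) • barlowOffset a') + (z m • layerNormal 1)) with hqdef
    have hqn : ‖q‖ ≤ 2 * R + ε / 2 := by
      have : ‖q‖ ≤ ‖y i + t‖ + dist (y i + t) q := by
        have := norm_le_norm_add_norm_sub' q (y i + t)
        rw [dist_eq_norm]
        linarith [norm_sub_rev (y i + t) q]
      linarith
    calc dist (y i + t) (c • q) ≤ dist (y i + t) q + dist q (c • q) := dist_triangle _ _ _
      _ ≤ ε / 2 + |c - 1| * ‖q‖ := by rw [hdist]; linarith
      _ ≤ ε / 2 + ε / 2 := by
          linarith [hb_rescale_aux hR hε ha ha' ha'1 ha1 hXa haa (abs_nonneg _) hqn]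
      _ = ε := by ring

/-! ## One in-layer spacing for all scales (accumulation point + rescaling) -/

/-- **Choosing one in-layer spacing.** Abstract form: `W N R ε ⊆ [47/50, 1]` is the set of
admissible spacings of `(R, ε)`-windows of the `N`-th configuration; if windows are monotone in
`(R, ε)`, trivial for `R < 0`, stable under the rescaling of `hb_window_rescale`, and exist
eventually in `N` for every `(R, ε)`, then ONE spacing `a` serves every `(R, ε)` frequently in `N`
(a cluster point of the spacings of `(k, 1/(k+1))`-windows along a diagonal subsequence).
[folklore] -/
theorem hb_exists_global_spacing (W : ℕ → ℝ → ℝ → Set ℝ)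
    (hbox : ∀ N R ε, W N R ε ⊆ Set.Icc (47 / 50 : ℝ) 1)
    (hmono : ∀ N R R₂ ε ε₂, R₂ ≤ R → ε ≤ ε₂ → W N R ε ⊆ W N R₂ ε₂)
    (hneg : ∀ N R ε a, R < 0 → a ∈ Set.Icc (47 / 50 : ℝ) 1 → a ∈ W N R ε)
    (hresc : ∀ N R ε a a', 0 ≤ R → 0 < ε → a' ∈ W N (2 * R + 1) (ε / 2) →
      a ∈ Set.Icc (47 / 50 : ℝ) 1 → |a - a'| ≤ ε / (8 * (R + 1)) → a ∈ W N R ε)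
    (hne : ∀ R ε, 0 < ε → ∀ᶠ N in atTop, (W N R ε).Nonempty) :
    ∃ a ∈ Set.Icc (47 / 50 : ℝ) 1, ∀ R ε, 0 < ε → ∃ᶠ N in atTop, a ∈ W N R ε := by
  have h1 : ∀ k : ℕ, ∀ᶠ N in atTop, (W N k (1 / ((k : ℝ) + 1))).Nonempty := fun k =>
    hne k _ (by positivity)
  obtain ⟨φ, hφ, hφW⟩ := extraction_forall_of_eventually h1
  choose aseq haseq using hφW
  have hmem : ∀ k, aseq k ∈ Set.Icc (47 / 50 : ℝ) 1 := fun k => hbox _ _ _ (haseq k)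
  obtain ⟨a, ha, ψ, hψ, hlim⟩ := isCompact_Icc.tendsto_subseq hmem
  refine ⟨a, ha, fun R ε hε => ?_⟩
  rcases lt_or_ge R 0 with hR | hR
  · exact Eventually.frequently (Eventually.of_forall fun N => hneg N R ε a hR ha)
  rw [frequently_atTop]
  intro M
  have hκ : 0 < ε / (8 * (R + 1)) := by positivity
  have e1 : ∀ᶠ j in atTop, dist (aseq (ψ j)) a < ε / (8 * (R + 1)) :=
    (Metric.tendsto_nhds.1 hlim) _ hκ
  have hψ' : Tendsto (fun j => ((ψ j : ℕ) : ℝ)) atTop atTop :=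
    tendsto_natCast_atTop_atTop.comp hψ.tendsto_atTop
  have e2 : ∀ᶠ j in atTop, 2 * R + 1 ≤ (ψ j : ℝ) := hψ'.eventually_ge_atTop _
  have e3 : ∀ᶠ j in atTop, 2 / ε ≤ (ψ j : ℝ) := hψ'.eventually_ge_atTop _
  have e4 : ∀ᶠ j in atTop, M ≤ φ (ψ j) := (hφ.comp hψ).tendsto_atTop.eventually_ge_atTop M
  obtain ⟨j, hj1, hj2, hj3, hj4⟩ := (e1.and (e2.and (e3.and e4))).exists
  refine ⟨φ (ψ j), hj4, ?_⟩
  have hmem' : aseq (ψ j) ∈ W (φ (ψ j)) (2 * R + 1) (ε / 2) := by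
    refine hmono _ _ _ _ _ hj2 ?_ (haseq (ψ j))
    rw [div_le_iff₀ (by positivity)]
    have h2 : 2 ≤ ε * (ψ j : ℝ) := by
      have := (div_le_iff₀ hε).1 hj3
      linarith
    nlinarith
  refine hresc _ _ _ _ _ hR hε hmem' ha ?_
  rw [abs_sub_comm, ← Real.dist_eq]
  exact hj1.le

/-! ## Windows: monotonicity and the trivial negative-radius case -/

/-- A window is monotone in its radius and tolerance. [folklore] -/
theorem hb_window_mono {N : ℕ} (y : Fin N → E3) {R R₂ ε ε₂ a : ℝ} (hR : R₂ ≤ R) (hε : ε ≤ ε₂)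
    (hW : ∃ (A : E3 →ₗᵢ[ℝ] E3) (t : E3) (s : ℤ → ℤ) (z : ℤ → ℝ), IsHaggSeq s ∧
      (∀ m : ℤ, 39 / 50 * a ≤ z (m + 1) - z m ∧ z (m + 1) - z m ≤ 17 / 20 * a) ∧
      let S : Set E3 := {p | ∃ m i j : ℤ, p = A (((i : ℝ) • triangularVec₁ a) +
        ((j : ℝ) • triangularVec₂ a) + ((haggLabel s m : ℝ) • barlowOffset a) +
        (z m • layerNormal 1))}
      (∀ p ∈ S, ‖p‖ ≤ R → ∃ i : Fin N, dist (y i + t) p ≤ ε) ∧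
      (∀ i : Fin N, ‖y i + t‖ ≤ R → ∃ p ∈ S, dist (y i + t) p ≤ ε)) :
    ∃ (A : E3 →ₗᵢ[ℝ] E3) (t : E3) (s : ℤ → ℤ) (z : ℤ → ℝ), IsHaggSeq s ∧
      (∀ m : ℤ, 39 / 50 * a ≤ z (m + 1) - z m ∧ z (m + 1) - z m ≤ 17 / 20 * a) ∧
      let S : Set E3 := {p | ∃ m i j : ℤ, p = A (((i : ℝ) • triangularVec₁ a) +
        ((j : ℝ) • triangularVec₂ a) + ((haggLabel s m : ℝ) • barlowOffset a) +
        (z m • layerNormal 1))}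
      (∀ p ∈ S, ‖p‖ ≤ R₂ → ∃ i : Fin N, dist (y i + t) p ≤ ε₂) ∧
      (∀ i : Fin N, ‖y i + t‖ ≤ R₂ → ∃ p ∈ S, dist (y i + t) p ≤ ε₂) := by
  obtain ⟨A, t, s, z, hs, hz, h12⟩ := hW
  dsimp only at h12
  obtain ⟨h1, h2⟩ := h12
  refine ⟨A, t, s, z, hs, hz, ?_⟩
  dsimp only
  refine ⟨fun p hp hpR => ?_, fun i hi => ?_⟩
  · obtain ⟨i, hi⟩ := h1 p hp (hpR.trans hR)
    exact ⟨i, hi.trans hε⟩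
  · obtain ⟨p, hp, hd⟩ := h2 i (hi.trans hR)
    exact ⟨p, hp, hd.trans hε⟩

/-- For a negative radius every spacing `a ≥ 0` carries a (vacuous) window: take the identity,
the all-`+1` Hägg word and equally spaced layers `z m = (4/5) a m`. [folklore] -/
theorem hb_window_neg {N : ℕ} (y : Fin N → E3) {R ε a : ℝ} (hR : R < 0) (ha : 0 ≤ a) :
    ∃ (A : E3 →ₗᵢ[ℝ] E3) (t : E3) (s : ℤ → ℤ) (z : ℤ → ℝ), IsHaggSeq s ∧
      (∀ m : ℤ, 39 / 50 * a ≤ z (m + 1) - z m ∧ z (m + 1) - z m ≤ 17 / 20 * a) ∧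
      let S : Set E3 := {p | ∃ m i j : ℤ, p = A (((i : ℝ) • triangularVec₁ a) +
        ((j : ℝ) • triangularVec₂ a) + ((haggLabel s m : ℝ) • barlowOffset a) +
        (z m • layerNormal 1))}
      (∀ p ∈ S, ‖p‖ ≤ R → ∃ i : Fin N, dist (y i + t) p ≤ ε) ∧
      (∀ i : Fin N, ‖y i + t‖ ≤ R → ∃ p ∈ S, dist (y i + t) p ≤ ε) := by
  refine ⟨LinearIsometry.id, 0, fun _ => 1, fun m => 4 / 5 * a * m, fun _ => Or.inl rfl,
    fun m => ?_, ?_⟩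
  · push_cast
    constructor <;> nlinarith
  · dsimp only
    exact ⟨fun p _ hpR => absurd (hpR.trans_lt hR) (not_lt.2 (norm_nonneg p)),
      fun i hi => absurd (hi.trans_lt hR) (not_lt.2 (norm_nonneg _))⟩

/-! ## Counting particles near a sparse set -/

/-- **Packing count.** In a `δ`-separated configuration the particles within `R'` of SOME
particle of `D` number at most `#D · (2R'/δ + 1)³`. [folklore] -/
theorem hb_card_near_le {N : ℕ} (y : Fin N → E3) {δ R' : ℝ} (hδ : 0 < δ) (hR' : 0 ≤ R')
    (hsep : ∀ i j : Fin N, i ≠ j → δ ≤ dist (y i) (y j)) (D : Finset (Fin N)) :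
    ((Finset.univ.filter fun i : Fin N => ∃ j ∈ D, dist (y j) (y i) ≤ R').card : ℝ) ≤
      D.card * (2 * R' / δ + 1) ^ 3 := by
  classical
  have hinj : Function.Injective y := by
    intro i j hij
    by_contra hne
    have := hsep i j hne
    rw [hij, dist_self] at this
    linarith
  -- the near set is the union over `j ∈ D` of the `R'`-neighbourhoods
  have hsub : (Finset.univ.filter fun i : Fin N => ∃ j ∈ D, dist (y j) (y i) ≤ R') ⊆
      D.biUnion fun j => Finset.univ.filter fun i : Fin N => dist (y j) (y i) ≤ R' := by
    intro i hi
    simp only [Finset.mem_filter, Finset.mem_univ, true_and] at hi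
    obtain ⟨j, hj, hd⟩ := hi
    exact Finset.mem_biUnion.2 ⟨j, hj, by simp [hd]⟩
  have hball : ∀ j : Fin N,
      (((Finset.univ.filter fun i : Fin N => dist (y j) (y i) ≤ R').card : ℝ)) ≤
        (2 * R' / δ + 1) ^ 3 := by
    intro j
    set s := Finset.univ.filter fun i : Fin N => dist (y j) (y i) ≤ R' with hs
    have hcard : (s.image y).card = s.card := Finset.card_image_of_injective _ hinj
    have := card_le_of_separated_of_dist_le (s.image y) (y j) hδ hR' ?_ ?_
    · rw [hcard, finrank_euclideanSpace_fin] at this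
      exact this
    · intro c hc
      obtain ⟨i, hi, rfl⟩ := Finset.mem_image.1 hc
      rw [dist_comm]
      exact (Finset.mem_filter.1 hi).2
    · intro c hc d hd hcd
      obtain ⟨i, hi, rfl⟩ := Finset.mem_image.1 hc
      obtain ⟨i', hi', rfl⟩ := Finset.mem_image.1 hd
      exact hsep i i' fun h => hcd (by rw [h])
  calc ((Finset.univ.filter fun i : Fin N => ∃ j ∈ D, dist (y j) (y i) ≤ R').card : ℝ)
      ≤ ((D.biUnion fun j => Finset.univ.filter fun i : Fin N => dist (y j) (y i) ≤ R').card : ℝ) := by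
        exact_mod_cast Finset.card_le_card hsub
    _ ≤ ∑ j ∈ D, (((Finset.univ.filter fun i : Fin N => dist (y j) (y i) ≤ R').card : ℝ)) := by
        exact_mod_cast Finset.card_biUnion_le
    _ ≤ ∑ j ∈ D, (2 * R' / δ + 1) ^ 3 := Finset.sum_le_sum fun j _ => hball j
    _ = D.card * (2 * R' / δ + 1) ^ 3 := by rw [Finset.sum_const, nsmul_eq_mul]

/-- **A clean ball.** If the `R'`-neighbourhoods of a set `D` of particles cannot cover all
particles (by the packing count), some particle has NO member of `D` within `R'`. [folklore] -/
theorem hb_exists_far_from {N : ℕ} (y : Fin N → E3) {δ R' : ℝ} (hδ : 0 < δ) (hR' : 0 ≤ R')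
    (hsep : ∀ i j : Fin N, i ≠ j → δ ≤ dist (y i) (y j)) (D : Finset (Fin N))
    (hD : (D.card : ℝ) * (2 * R' / δ + 1) ^ 3 < N) :
    ∃ i : Fin N, ∀ j : Fin N, dist (y j) (y i) ≤ R' → j ∉ D := by
  classical
  have hlt : ((Finset.univ.filter fun i : Fin N => ∃ j ∈ D, dist (y j) (y i) ≤ R').card : ℝ) <
      (Finset.univ : Finset (Fin N)).card := by
    rw [Finset.card_univ, Fintype.card_fin]
    exact (hb_card_near_le y hδ hR' hsep D).trans_lt hD
  have hne : (Finset.univ.filter fun i : Fin N => ∃ j ∈ D, dist (y j) (y i) ≤ R') ≠ Finset.univ := by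
    intro h
    rw [h] at hlt
    exact lt_irrefl _ hlt
  obtain ⟨i, -, hi⟩ : ∃ i ∈ (Finset.univ : Finset (Fin N)),
      i ∉ Finset.univ.filter fun i : Fin N => ∃ j ∈ D, dist (y j) (y i) ≤ R' := by
    by_contra h
    push Not at h
    exact hne (Finset.eq_univ_of_forall fun i => h i (Finset.mem_univ i))
  refine ⟨i, fun j hj hjD => hi ?_⟩
  simp only [Finset.mem_filter, Finset.mem_univ, true_and]
  exact ⟨j, hjD, hj⟩

end Summit.AtomisticToContinuum.Crystallization.Theorems
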